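import Summits.KontsevichZagierPeriods.KontsevichZagierPeriods.Theorems.HurwitzMicroSectorsNormalFormPrincipleL2W3Carriers
import Summits.KontsevichZagierPeriods.KontsevichZagierPeriods.Theorems.HurwitzMicroSectorsNormalFormPrincipleL2W3ExistsChartTargets
import Summits.KontsevichZagierPeriods.KontsevichZagierPeriods.Theorems.HurwitzMicroSectorsNormalFormPrincipleM3EbdBoxSubSimplex
import Summits.KontsevichZagierPeriods.KontsevichZagierPeriods.Theorems.HurwitzMicroSectorsNormalFormPrincipleL2W3RelationsDilation
import Summits.KontsevichZagierPeriods.KontsevichZagierPeriods.Theorems.HyperbolicBlochOffTetraSectorKernelStubAffineOrbit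

/-!
# `NormalFormPrinciple` (stmt-KontsevichZagierPeriods-3869), line `SketchIdeator1` —
# layer `M4`: the box form of the dilation relation, `[(0,1)³, 4/(1+xyz)] ∼ [(0,1)³, 3/(1−xyz)]`

Pure proof file (registered sub-goal `m4_negZetaThree_box`, lead seat c9; `--supports` the crux).
Inside the Kontsevich–Zagier calculus we prove that ANY representation of `[(0,1)³, 4/(1+xyz)]`
is equivalent to ANY representation of `[(0,1)³, 3/(1−xyz)]` — numerically
`∫_{□³} 4 dV/(1+xyz) = 4·(¾ζ(3)) = 3ζ(3) = ∫_{□³} 3 dV/(1−xyz)` — as a chain of moves: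

* two cubical charts (rule 2, `M3.ebd_box_sub_simplex`): along `t = (x, xy, xyz)` the boxes become
  `[Δ, 4/(t₀t₁(1+t₂))]` and `[Δ, 3/(t₀t₁(1−t₂))]` on the decreasing open simplex
  `Δ = {1 > t₀ > t₁ > t₂ > 0}` (the two simplex-side carriers are built here, dominated by `4G`,
  `3G` with `G = 1/(t₀t₁(1−t₂))` the `ζ(3)` kernel);
* two integrand scalings (rule 1b, `aff_orbit_of_sub_sum_zsmul_mem_relations`):
  `[Δ, 4/(t₀t₁(1+t₂))] = 4[aac]`, `[Δ, 3/(t₀t₁(1−t₂))] = 3[aab]` with the word carriers of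
  `l2w3_carriers` (letters `a(u) = 1/u`, `b(u) = 1/(1−u)`, `c(u) = 1/(1+u)`);
* one dilation relation `3[aab] − 4[aac] ∈ KZ.relations` (first conjunct of
  `l2w3_relations_dilation`: the distribution relation of level 2 in weight 3).

The lead multiplies this dimension-three equivalence by the log box (product ideal) to obtain the
first DIMENSION-FOUR instance `[□⁴, 4/((1+x)(1+yzw))] ∼ [□⁴, 3/((1+x)(1−yzw))]`.
Sources: M. Kontsevich, D. Zagier, *Periods* (2001), §1.1–1.2. No definitions are introduced.
-/

noncomputable section

open MeasureTheory Set
open Literature.NumberTheory.Transcendental Literature.NumberTheory.Transcendental.KZ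
open Summit.KontsevichZagierPeriods.HyperbolicBloch.OffTetraSectorKernel
  (aff_orbit_of_sub_sum_zsmul_mem_relations)

namespace Summit.KontsevichZagierPeriods.HurwitzMicroSectors.NormalFormPrinciple.PiBox.M3

/-! ## The two simplex-side carriers -/

/-- `[Δ, 4/(t₀t₁(1+t₂))]` exists (chart target of the box `[(0,1)³, 4/(1+xyz)]`; a quotient of
`ℚ`-polynomials with non-vanishing denominator on `Δ`, dominated by `4G`, `G = 1/(t₀t₁(1−t₂))`,
since `1−t₂ ≤ 1+t₂`). [cite: KontsevichZagier2001, §1.1] -/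
theorem m4a_exists_TC :
    ∃ T : IntegralRep 3, T.domain = {t | 0 < t 2 ∧ t 2 < t 1 ∧ t 1 < t 0 ∧ t 0 < 1} ∧
      T.integrand = fun t => 4 / (t 0 * t 1 * (1 + t 2)) := by
  have hq : ∀ t ∈ {t : Fin 3 → ℝ | 0 < t 2 ∧ t 2 < t 1 ∧ t 1 < t 0 ∧ t 0 < 1},
      (MvPolynomial.aeval t (MvPolynomial.X 0 * MvPolynomial.X 1 * (1 + MvPolynomial.X 2) :
        MvPolynomial (Fin 3) ℚ) : ℝ) ≠ 0 := by
    intro t ht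
    obtain ⟨h0, h1, -, -⟩ := ebd2_pos_of_mem_simplex ht
    have h2' : 0 < 1 + t 2 := by linarith [(l2b_mem_Ioo_of_mem_simplex ht 2).1]
    simp only [map_mul, map_add, map_one, MvPolynomial.aeval_X]
    positivity
  have hle : ∀ t ∈ {t : Fin 3 → ℝ | 0 < t 2 ∧ t 2 < t 1 ∧ t 1 < t 0 ∧ t 0 < 1},
      |(MvPolynomial.aeval t (4 : MvPolynomial (Fin 3) ℚ) : ℝ) /
        MvPolynomial.aeval t (MvPolynomial.X 0 * MvPolynomial.X 1 * (1 + MvPolynomial.X 2) :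
          MvPolynomial (Fin 3) ℚ)|
        ≤ 4 * (1 / (t 0 * t 1 * (1 - t 2))) := by
    intro t ht
    obtain ⟨h0, h1, -, -⟩ := ebd2_pos_of_mem_simplex ht
    have ht2 := l2b_mem_Ioo_of_mem_simplex ht 2
    simp only [map_ofNat, map_mul, map_add, map_one, MvPolynomial.aeval_X]
    refine l2b_div_le_mul_G ht (by norm_num) le_rfl ?_
    -- `t₀t₁(1−t₂) ≤ t₀t₁(1+t₂)` since `0 < t₂`
    have h01 : 0 < t 0 * t 1 := mul_pos h0 h1
    nlinarith [mul_pos h01 ht2.1]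
  obtain ⟨T, hTd, hTi⟩ := l2b_exists_of_aeval 4 hq hle
  exact ⟨T, hTd, hTi.trans (funext fun t => by
    simp only [map_ofNat, map_mul, map_add, map_one, MvPolynomial.aeval_X])⟩

/-- `[Δ, 3/(t₀t₁(1−t₂))]` exists (chart target of the box `[(0,1)³, 3/(1−xyz)]`, i.e. `3G` with
`G` the `ζ(3)` kernel). [cite: KontsevichZagier2001, §1.1] -/
theorem m4a_exists_TA :
    ∃ T : IntegralRep 3, T.domain = {t | 0 < t 2 ∧ t 2 < t 1 ∧ t 1 < t 0 ∧ t 0 < 1} ∧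
      T.integrand = fun t => 3 / (t 0 * t 1 * (1 - t 2)) := by
  have hq : ∀ t ∈ {t : Fin 3 → ℝ | 0 < t 2 ∧ t 2 < t 1 ∧ t 1 < t 0 ∧ t 0 < 1},
      (MvPolynomial.aeval t (MvPolynomial.X 0 * MvPolynomial.X 1 * (1 - MvPolynomial.X 2) :
        MvPolynomial (Fin 3) ℚ) : ℝ) ≠ 0 := by
    intro t ht
    obtain ⟨h0, h1, -, h2⟩ := ebd2_pos_of_mem_simplex ht
    simp only [map_mul, map_sub, map_one, MvPolynomial.aeval_X]
    positivity
  have hle : ∀ t ∈ {t : Fin 3 → ℝ | 0 < t 2 ∧ t 2 < t 1 ∧ t 1 < t 0 ∧ t 0 < 1},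
      |(MvPolynomial.aeval t (3 : MvPolynomial (Fin 3) ℚ) : ℝ) /
        MvPolynomial.aeval t (MvPolynomial.X 0 * MvPolynomial.X 1 * (1 - MvPolynomial.X 2) :
          MvPolynomial (Fin 3) ℚ)|
        ≤ 3 * (1 / (t 0 * t 1 * (1 - t 2))) := by
    intro t ht
    simp only [map_ofNat, map_mul, map_sub, map_one, MvPolynomial.aeval_X]
    exact l2b_div_le_mul_G ht (by norm_num) le_rfl le_rfl
  obtain ⟨T, hTd, hTi⟩ := l2b_exists_of_aeval 3 hq hle
  exact ⟨T, hTd, hTi.trans (funext fun t => by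
    simp only [map_ofNat, map_mul, map_sub, map_one, MvPolynomial.aeval_X])⟩

/-! ## The registered sub-goal -/

/-- **Stub (`m4_negZetaThree_box`; registered sub-goal of stmt-KontsevichZagierPeriods-3869,
line `SketchIdeator1`, layer `M4`).** Any representation of `[(0,1)³, 4/(1+xyz)]` is
KZ-equivalent to any representation of `[(0,1)³, 3/(1−xyz)]`
(`4∫dV/(1+xyz) = 4·¾ζ(3) = 3ζ(3)`): the two cubical charts `t = (x, xy, xyz)` (rule 2) give
`[Δ, 4/(t₀t₁(1+t₂))] = 4[aac]` and `[Δ, 3/(t₀t₁(1−t₂))] = 3[aab]` (rule 1b), and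
`3[aab] − 4[aac]` is the dilation (distribution) relation `l2w3_relations_dilation.1`.
[cite: KontsevichZagier2001, §1.2 rules (1), (2)] -/
theorem m4_negZetaThree_box :
    ∀ (N N' : IntegralRep 3), N.domain = {x | ∀ i, x i ∈ Set.Ioo (0:ℝ) 1} →
      EqOn N.integrand (fun x => 4 / (1 + x 0 * x 1 * x 2)) N.domain →
      N'.domain = {x | ∀ i, x i ∈ Set.Ioo (0:ℝ) 1} →
      EqOn N'.integrand (fun x => 3 / (1 - x 0 * x 1 * x 2)) N'.domain →
      Equivalent N N' := by
  intro N N' hNd hNi hN'd hN'i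
  obtain ⟨AAB, _, AAC, _, _, _, _, _, _, _, _, _, _, _, _, _, ⟨hAABd, hAABi⟩, -, ⟨hAACd, hAACi⟩,
    -⟩ := l2w3_carriers
  obtain ⟨TC, hTCd, hTCi⟩ := m4a_exists_TC
  obtain ⟨TA, hTAd, hTAi⟩ := m4a_exists_TA
  -- rule (2): the cubical chart of the first box, `4/(1+xyz) = 4/(t₀t₁(1+t₂)) · x₀²x₁`
  have e1 : of N - of TC ∈ relations := by
    refine ebd_box_sub_simplex (fun t => 4 / (t 0 * t 1 * (1 + t 2))) N TC hNd hTCd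
      (hTCi ▸ fun _ _ => rfl) fun x hx => ?_
    have hx' : ∀ i, x i ∈ Set.Ioo (0:ℝ) 1 := by rw [hNd] at hx; exact hx
    have h0 : x 0 ≠ 0 := (hx' 0).1.ne'
    have h1 : x 1 ≠ 0 := (hx' 1).1.ne'
    have h012p : 1 + x 0 * x 1 * x 2 ≠ 0 := by
      have := mul_pos (mul_pos (hx' 0).1 (hx' 1).1) (hx' 2).1
      linarith
    rw [hNi hx]
    simp only [Matrix.cons_val_zero, Matrix.cons_val_one, Matrix.cons_val_two, Matrix.head_cons,
      Matrix.tail_cons]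
    field_simp
  -- rule (1b): `[Δ, 4/(t₀t₁(1+t₂))] = 4[aac]`
  have e1' : of TC - (4:ℤ) • of AAC ∈ relations := by
    have h := aff_orbit_of_sub_sum_zsmul_mem_relations (Finset.univ : Finset (Fin 1))
      ![AAC] ![4] TC (fun i _ => by fin_cases i; exact hAACd.trans hTCd.symm) fun t ht => ?_
    · simpa using h
    have hf := l2v_simplex_facts (hTCd ▸ ht)
    simp only [Finset.univ_unique, Fin.default_eq_zero, Finset.sum_singleton, Matrix.cons_val_zero,
      hTCi, hAACi]
    have h0 : t 0 ≠ 0 := hf.1.ne'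
    have h1 : t 1 ≠ 0 := hf.2.2.1.ne'
    have h2b : 1 + t 2 ≠ 0 := by linarith [hf.2.2.2.2.1]
    push_cast
    field_simp
  -- rule (2): the cubical chart of the second box, `3/(1−xyz) = 3/(t₀t₁(1−t₂)) · x₀²x₁`
  have e2 : of N' - of TA ∈ relations := by
    refine ebd_box_sub_simplex (fun t => 3 / (t 0 * t 1 * (1 - t 2))) N' TA hN'd hTAd
      (hTAi ▸ fun _ _ => rfl) fun x hx => ?_
    have hx' : ∀ i, x i ∈ Set.Ioo (0:ℝ) 1 := by rw [hN'd] at hx; exact hx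
    have h0 : x 0 ≠ 0 := (hx' 0).1.ne'
    have h1 : x 1 ≠ 0 := (hx' 1).1.ne'
    have h012m : 1 - x 0 * x 1 * x 2 ≠ 0 := by
      have := mul_lt_one_of_nonneg_of_lt_one_left (mul_pos (hx' 0).1 (hx' 1).1).le
        (mul_lt_one_of_nonneg_of_lt_one_left (hx' 0).1.le (hx' 0).2 (hx' 1).2.le) (hx' 2).2.le
      exact (sub_pos.2 this).ne'
    rw [hN'i hx]
    simp only [Matrix.cons_val_zero, Matrix.cons_val_one, Matrix.cons_val_two, Matrix.head_cons,
      Matrix.tail_cons]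
    field_simp
  -- rule (1b): `[Δ, 3/(t₀t₁(1−t₂))] = 3[aab]`
  have e2' : of TA - (3:ℤ) • of AAB ∈ relations := by
    have h := aff_orbit_of_sub_sum_zsmul_mem_relations (Finset.univ : Finset (Fin 1))
      ![AAB] ![3] TA (fun i _ => by fin_cases i; exact hAABd.trans hTAd.symm) fun t ht => ?_
    · simpa using h
    have hf := l2v_simplex_facts (hTAd ▸ ht)
    simp only [Finset.univ_unique, Fin.default_eq_zero, Finset.sum_singleton, Matrix.cons_val_zero,
      hTAi, hAABi]
    have h0 : t 0 ≠ 0 := hf.1.ne'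
    have h1 : t 1 ≠ 0 := hf.2.2.1.ne'
    have h2a : 1 - t 2 ≠ 0 := by linarith [hf.2.2.2.2.2]
    push_cast
    field_simp
  -- the dilation (distribution) relation `3[aab] − 4[aac]`
  have rel1 : (3:ℤ) • of AAB - (4:ℤ) • of AAC ∈ relations :=
    l2w3_relations_dilation.1 AAB hAABd hAABi AAC hAACd hAACi
  have e : of N - of N' = (of N - of TC) + (of TC - (4:ℤ) • of AAC)
      - ((3:ℤ) • of AAB - (4:ℤ) • of AAC) - (of TA - (3:ℤ) • of AAB) - (of N' - of TA) := by
    abel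
  show of N - of N' ∈ relations
  rw [e]
  exact relations.sub_mem (relations.sub_mem (relations.sub_mem (relations.add_mem e1 e1') rel1)
    e2') e2

end Summit.KontsevichZagierPeriods.HurwitzMicroSectors.NormalFormPrinciple.PiBox.M3
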